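import Summits.Ventures.HSemireg.Pad4TowerPsiSubA1

/-!
# B3MonadCohomology — (B3)∕(α′): the display cohomology of a three-term box monad `A → N → C` on the PAD-4 anchor,
# as decidable letter predicates over the tree's `Pad4Tower` vocabulary (hsemireg-monad-4 g2)

Seat `hsemireg-monad-4` g2 (planner, MECH pen + typing; cell `pub-hsemireg`, director-hodge MINT block A3), evidence-only on
crux H2 = `stmt-HodgeConjecture-18881` = `Summit.HodgeConjecture.HodgeConjecture.Theses.EightfoldBlochSeeds.BlochSeedDiscOne`;
skeleton `Lines/birth.lean` 814a6a70c14e831a and its stub `stub_rung_pad4_seedAt` are UNTOUCHED.  Companion memo (pen + the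
checkable table): `Cruxes/BlochSeedDiscOne/B3-MONAD-COHOMOLOGY-monad4-g2.md`; predecessor (g0, HOME only): memo
`B3-MONAD-COHOMOLOGY-monad4-g0.md` v1.2 39be82d7, code `b3cohom.py` 444595d9, standalone typed file `B3Spec.lean` af8bfded.

HONEST FRAMING.  Nothing in this file is proved toward HC ∕ HC_CM ∕ HC_AV ∕ №4 ∕ 26512 ∕ 18881 ∕ H2; it is KERNEL COMBINATORICS
about DESIGNS (cells + integer multiplicities) — designs ≠ supports; class-alive ≠ Hall-passing ≠ monad ≠ SOURCE ≠ SEED.  No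
geometry is imported: the geometric DICTIONARY below (Mumford's index theorem, Künneth, the hypercohomology spectral sequence,
Krull–Schmidt) is pen, stated in the docstrings, and every `theorem` is a statement about finite sums over `Finset MCell`.
No proof holes, no axioms, no type-class instances declared, no custom syntax, no `native_decide`, no banned option.

## Vocabulary (tree, imported): `BPoint = ℤ × ℤ × ℤ` = a balanced factor point `x = (α, Re β, Im β)` = the class of the line
bundle `L_x` on one factor `S = E_i × E_{−i}` with Hermitian form `[[α, β], [β̄, α]]` (`χ(L_x) = α² − |β|² = bphi x 5`);
`Effective Δ ⟺ 0 ≤ α ∧ |β|² ≤ α²` (closed future cone); `MCell = Fin 4 → BPoint` = a box `L_Z = ⊠_f L_{Z f}` on the 8-fold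
`X = S⁴` up to `Pic⁰`; `MCell.le P Z ⟺ ∀ f, Effective (Z f − P f)`; `MCell.ch` = the class tensor on the word frame `CWord`.
A `BoxMonad` (§3) is FIELD FOR FIELD `MonadAlphabet.MonadDesign bAlph` (`A N C`, `mA mN mC`); that crux workfile is not
imported only because cross-crux imports were not built on the farm when this file was checked (rc 75 «unbuilt», 2026-08-29
20:30Z) — every definition here is stated so that the identification is `rfl` once the two are co-importable.

## The LIVE RELATION is a PARAMETER `L : MCell → MCell → Prop` («there may be a non-zero map `L_x ⊗ α → L_y ⊗ α′`»).
RULE A of the (B3) memos made formal: the relation OF RECORD is the class-level superset `MCell.le` (a line bundle on an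
abelian surface with a non-zero section has positive-semidefinite Hermitian form), and every finer relation is a sub-relation
`L ≤ MCell.le`.  COARSENING DICTIONARY for LABELLED designs (Pic⁰-classes per copy, τ-bits of a lift `D♯_F`): vertices :=
cells, multiplicity := the sum over the labels sitting on the cell (the τ-lift of sheaf8-1 `taulift.py` ∕ monad-1 `lift4.py`
puts all `2^|F|` patterns on every copy, so its coarsening is EXACTLY `D.smul (2^|F|)`), and `L♯(n, c) :⇔` SOME pair of labels
on `n`, `c` is live — a sub-relation of `MCell.le`.  The `q`-side Krull–Schmidt necessity SURVIVES coarsening (pen, (B3.2♭)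
below: no copy outside `N(Γ)`-cells maps to any copy of a `Γ`-cell, so `q` restricts to an equal-rank surjection, hence an
isomorphism, of the FULL label sums; Krull–Schmidt equates multisets of line bundles, and a line bundle determines its CELL —
labels only move it inside `Pic⁰`), and so do plain Hall and the closure inequality (rows onto all copies of `Γ` see only
copies of `N(Γ)`-cells).  Hence every predicate below that is NECESSARY for a monad is necessary, on the coarsening, under
every labelling, and §6 proves the two monotonicity laws (in `L` and in the multiplicities) that turn a violation for
`(MCell.le, D)` into a violation for `(L♯, k·D)`.  The finer class-level statements of record — colour-1's LIFTING LEMMA with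
kill sets (`T1e-LIFTING-LEMMA-colour1-g2.md` 6b50bd63; pen idea-crit-6 l.8018, monad-1 g4 2e8e2a89) and bc5-plan g14's R8 LIFT
SANDWICH `k_min(D) ≤ k_min(D♯_F) ≤ 2^|F|·k_min(D)` (memo 317a232e §2; pen idea-crit-6 l.8055) — say more (no NEW tight block
appears among non-rectangular label sets; keyed rows); this file's lift corollaries are their kill-free, cell-level shadow
«a death of record persists», kernel-checked, and claim nothing about kill sets.

## Dictionary (pen; memo §1–§2 of g0 v1.2, unchanged): for `t ∈ ℤ` the twist `L_Z(t) = L_Z ⊗ 𝒪(t·h)`, `h = Σ_f pr_f^* Θ`, is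
`α_f ↦ α_f + t` on every factor.  MUMFORD INDEX THEOREM (Abelian Varieties §16) + Riemann–Roch on one factor: a
non-degenerate `L_x` has cohomology in the single degree `i(x)` = number of negative eigenvalues of its form, of dimension
`|α² − |β|²|`; so for `x` AMPLE (`α > 0`, `|β| < α`): `h⁰ = α² − |β|²`, `h^{>0} = 0`, for every `Pic⁰`-twist.  KÜNNETH: for a
cell all of whose twisted letters are ample, `h⁰(L_Z(t) ⊗ α) = cellW t Z = Π_f ((α_f + t)² − |β_f|²)` and `h^{>0} = 0`.
(B3.1) DISPLAY THEOREM: for maps `𝒜 →ⁱ 𝒩 →^q 𝒞` on the design's terms with `i` injective, `q` surjective, `q ∘ i = 0`,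
`𝓔 = ker q ∕ im i`, the hypercohomology spectral sequence gives, at every level `t` with all three terms ample and every
`α ∈ Pic⁰`:  `H^{≥2}(𝓔(t) ⊗ α) = 0`, `H¹(𝓔(t) ⊗ α) = coker H⁰(q(t) ⊗ α)`, `h⁰ − h¹ = chiAt D t`.
(B3.2⁺) CLOSURE INEQUALITY (`ClosureIneq`, §4): `h¹(𝓔(t) ⊗ α) ≥ w_t(V) + w_t(T) − w_t(U)` for every `U ⊆ N`-cells, every
`V ⊆ C`-cells fed only from `U` and every `T ⊆ A`-cells mapping only into `U` (rows `V` of `H⁰(q)` see only `H⁰(𝒩_U)`, which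
contains the `H⁰(i)`-image of `H⁰(𝒜_T)`, killed by `q ∘ i = 0`).  So `IT₀` at level `t` needs `ClosureIneq L D t`; `U = N`
gives `chiAt D t ≥ 0` (kernel: `chiAt_nonneg_of_closureIneq`).
(B3.2♭) TIGHT-BLOCK LAW, Krull–Schmidt face (`KSTightC ∕ KSTightA`, §5; the cell's TIGHT rule ∕ rule (C): monad-1 memo
f6b5677c §3, idea-crit-6 memo cd5794c3 §2(b) — three proofs: nef determinant, Krull–Schmidt [Atiyah, Bull. SMF 84 (1956),
Thm. 3], degree `c₁·h⁷`): if `Γ ⊆ C`-cells is MULTIPLICITY-TIGHT (`Σ_Γ m_C = Σ_{N(Γ)} m_N`, `N(Γ)` = its `L`-live feeders)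
then a surjective `q` restricts to a surjection `𝒩_{N(Γ)} ↠ 𝒞_Γ` of vector bundles of equal rank, i.e. an ISOMORPHISM, and
Krull–Schmidt forces the two weighted multisets of line bundles to agree: `N(Γ) = Γ` as cells with `m_N = m_C` on it (an
IDENTITY block, cancellable in the display).  Dually for `A`-blocks and a sub-bundle `i`.  Faces: full class tensor
(`defectC = 0`), first Chern class per factor (`deltaC = 0`, the `delta_c1` printed by `b3cohom.py`) — kernel corollaries
`defectC_eq_zero_of_idBlock`, `noBadTightC_of_ks`.  When the `N`-level and the `C`-level share no cell (BAND ∕ № 53 ∕ B2SURV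
∕ MINMU designs of record; NOT the LINE designs: S′ shares 545 cells, S131 1 049) «Hall ∧ KS» is exactly STRICT Hall
(`strictHallQ_of_disjoint`, `hallQ_of_strict`, `ks_of_strict`).
(B3.3) what (B3) buys (cited, no new claim): with `i` a sub-bundle and `q` onto, `𝓔` is locally free of rank
`rank D = Σ m_N − Σ m_A − Σ m_C` with `ch(𝓔) = D.wch` (Whitney); a rank-`r` bundle has `c_k = 0` for `k > r` — the NEWTON
CLOSURE `(R_r)` on `D.wch`, typed for `r = 4` in `StrengthenRank4Closure.lean` (`c5H3_LINE14`, `c5H3_M72`, `c5H3_N46`: every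
rank-4 design of record fails it) and EMPTY for `r ≥ 8` on the 8-fold; it is cited, not re-typed, here.  For `t` with `𝓔(t)`
`IT₀`, `𝓔(t+1)` is `IT₀` and globally generated (Pareschi–Popa, JAMS 16 (2003), Thm. 2.4 ∕ Prop. 2.9).
(B3.4) the `End 𝓔` page ((A2)₁ bookkeeping) is letter-level pair sums of the same kind; not typed here (it needs the maps).

## Kernel content (this file): §4 `chiAt_nonneg_of_closureIneq`; §5 `deltaC_eq_zero_of_idBlock`, `defectC_eq_zero_of_idBlock`,
`noBadTightC_of_ks`, `strictHallQ_of_disjoint`; §6 ARC MONOTONICITY `not_hallKS_of_badTightC` (an `L`-tight non-identity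
`C`-block kills «HallQ ∧ KSTightC» under EVERY sub-relation `L′ ≤ L` when the `N`-multiplicities are positive — the tight
row's labelling-blindness), SCALING `badTightC_smul_iff` (`D ↦ k·D`, `k ≠ 0`), and their corollary `lift_inherits_badTightC` (§6b: the same pair
`closureIneq_of_sub`, `closureIneq_smul_iff`, `lift_inherits_closure_violation` for (B3.2⁺)):
the canonical τ-LIFT `D♯_F` of director-hodge R19.341 is `2^|F|·D` at cell level (sheaf8-1 `taulift.py`: each copy class is
replaced by `2^|F|` label patterns), so every tight-block death of record is inherited by every lift under every labelling;
(pen identification, not re-run here: the day's R8 `k = 0` kills — bc5-plan g14 «U-FAMILY-R8» l.8064, 512 singleton `P`-cells fed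
only by the 16-cell `A(n,0,0,0)` orbit of mass `16·32 = 512`, letter multisets disjoint; RB16♯ «TIGHT 64 P → 34 N» l.8060 — are
`BadTightA` instances in this vocabulary, the LINE designs' (B3.2♭) FAIL of R19.204 a `BadTightC` one);
§6c THE MAXIMAL TIGHT BLOCK (memo pen lemma P3, kernel part): under plain Hall tight blocks are closed under union
(`tightC_union`, submodularity), so `tightUnionC` = the union of all tight `C`-blocks is the maximal one (`tightUnionC_tight`),
and for a reflexive live relation with positive `N`-multiplicities `KSTightC ↔ IdBlockC (tightUnionC)` (`ks_iff_tightUnionC_id`,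
`ks_iff_tightUnionC_id_le` on the relation of record via `mCell_le_refl`; `A`-side twins) — ONE block decides the row, which is
what the companion scan `tightscan.py` computes by one max-flow per side (sink side of the canonical minimum cut; that this set is
`tightUnionC` is max-flow∕min-cut theory, pen);
§8 the ac808a66 tight pair as a two-cell toy (`w_gap_factor`, `w_gap_pos`, `toy_closure_fails`, `toy_badTight`,
`toy_lift_dead`, `toy_lift_closure_fails`, `toy_tightUnionC`), all by `decide` ∕ `ring` ∕ `linarith`.
v2 (§6c added) supersedes v1 307b8e6811e9fbb3 of the same path; v1's declarations are unchanged.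
-/

set_option linter.dupNamespace false

namespace Summit.HodgeConjecture.HodgeConjecture.Cruxes.BlochSeedDiscOne.B3MonadCohomology

open Finset Summit.Ventures.HSemireg.Pad4Tower

/-! ## §1 One factor: norm, twist, ampleness -/

/-- `n(x) = α² − |β|² = χ(L_x)` (`= D²∕2`); the tree's `p`-letter `bphi x 5`. -/
def bnorm (x : BPoint) : ℤ := x.1 ^ 2 - x.2.1 ^ 2 - x.2.2 ^ 2

/-- consistency with the tree's letter vector: `bphi x 5 = n(x)`. -/
theorem bphi_five (x : BPoint) : bphi x 5 = (bnorm x : GaussianInt) := rfl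

/-- twist by `t` copies of the principal polarisation: `α ↦ α + t`. -/
def btwist (t : ℤ) (x : BPoint) : BPoint := (x.1 + t, x.2.1, x.2.2)

/-- `n` at level `t`: `χ(L_x(t)) = (α + t)² − |β|²`. -/
def bnormAt (t : ℤ) (x : BPoint) : ℤ := (x.1 + t) ^ 2 - x.2.1 ^ 2 - x.2.2 ^ 2

theorem bnormAt_eq (t : ℤ) (x : BPoint) : bnormAt t x = bnorm (btwist t x) := rfl

theorem bnormAt_zero (x : BPoint) : bnormAt 0 x = bnorm x := by simp [bnormAt, bnorm]

/-- AMPLE letter: positive-definite form (`α > 0`, `|β|² < α²`); then `h⁰ = n`, `h^{>0} = 0` for every `Pic⁰`-twist (Mumford §16). -/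
abbrev BAmple (x : BPoint) : Prop := 0 < x.1 ∧ x.2.1 ^ 2 + x.2.2 ^ 2 < x.1 ^ 2

theorem bnorm_pos_of_ample {x : BPoint} (h : BAmple x) : 0 < bnorm x := by
  unfold bnorm; obtain ⟨-, h2⟩ := h; linarith

/-- ampleness persists upward in the twist. -/
theorem bAmple_btwist_mono {x : BPoint} {t t' : ℤ} (htt : t ≤ t') (h : BAmple (btwist t x)) : BAmple (btwist t' x) := by
  simp only [BAmple, btwist] at h ⊢
  obtain ⟨h1, h2⟩ := h
  refine ⟨by linarith, lt_of_lt_of_le h2 ?_⟩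
  nlinarith

/-- the inverse letter (dual line bundle). -/
def bneg (x : BPoint) : BPoint := (-x.1, -x.2.1, -x.2.2)

/-! ## §2 Cells: the weight `w_t` (= `χ` of the twisted box, = `h⁰` once ample) -/

/-- `w_t(Z) = Π_f ((α_f + t)² − |β_f|²) = χ(L_Z(t))`; `= h⁰(L_Z(t) ⊗ α)` for every `α ∈ Pic⁰` when every twisted letter is ample. -/
def cellW (t : ℤ) (Z : MCell) : ℤ := ∏ f, bnormAt t (Z f)

/-- every letter of `Z`, twisted by `t`, is ample. -/
abbrev CellAmpleAt (t : ℤ) (Z : MCell) : Prop := ∀ f, BAmple (btwist t (Z f))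

theorem cellW_pos_of_ample {t : ℤ} {Z : MCell} (h : CellAmpleAt t Z) : 0 < cellW t Z :=
  Finset.prod_pos fun f _ => by rw [bnormAt_eq]; exact bnorm_pos_of_ample (h f)

/-- the inverse box. -/
def cneg (Z : MCell) : MCell := fun f => bneg (Z f)

/-! ## §3 Three-term box-monad DESIGNS (= `MonadAlphabet.MonadDesign bAlph`, field for field) -/

/-- a three-term box-monad design `⊕_{a ∈ A} L_a^{m_A a} →ⁱ ⊕_{n ∈ N} L_n^{m_N n} →^q ⊕_{c ∈ C} L_c^{m_C c}` — cells and integer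
multiplicities only, no maps, no labels.  Class `N − A − C`. -/
structure BoxMonad where
  /-- the `A`-cells (sub term, source of `i`) -/
  A : Finset MCell
  /-- the `N`-cells (middle term) -/
  N : Finset MCell
  /-- the `C`-cells (quotient term, target of `q`) -/
  C : Finset MCell
  /-- multiplicities of the `A`-cells -/
  mA : MCell → ℤ
  /-- multiplicities of the `N`-cells -/
  mN : MCell → ℤ
  /-- multiplicities of the `C`-cells -/
  mC : MCell → ℤ

/-- weighted cell count of a family. -/
def mass (m : MCell → ℤ) (S : Finset MCell) : ℤ := ∑ Z ∈ S, m Z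

/-- weighted `w_t`-mass of a family (`= h⁰` of the twisted term once ample). -/
def wOf (m : MCell → ℤ) (t : ℤ) (S : Finset MCell) : ℤ := ∑ Z ∈ S, m Z * cellW t Z

/-- weighted class tensor of a family: `Σ m_Z · ch(Z)`. -/
def wchOf (m : MCell → ℤ) (S : Finset MCell) : CWord → GaussianInt := ∑ Z ∈ S, m Z • Z.ch

namespace BoxMonad

variable (D : BoxMonad)

/-- designed rank `Σ m_N − Σ m_A − Σ m_C`. -/
def rank : ℤ := mass D.mN D.N - mass D.mA D.A - mass D.mC D.C

/-- `χ_D(t) = Σ_N m w_t − Σ_A m w_t − Σ_C m w_t` (`= χ(𝓔(t) ⊗ α)` for any monad on `D`). -/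
def chiAt (t : ℤ) : ℤ := wOf D.mN t D.N - wOf D.mA t D.A - wOf D.mC t D.C

/-- the design's class tensor `ch(N) − ch(A) − ch(C)` (`= MonadDesign.wch` over `bAlph`; `= ch(𝓔)` for any monad on `D`). -/
def wch : CWord → GaussianInt := wchOf D.mN D.N - wchOf D.mA D.A - wchOf D.mC D.C

/-- (H1)∕(A1): the class tensor passes the tree's class screen. -/
def Clean : Prop := ClassScreen D.wch

/-- `μ` = the `e⊗e⊗e⊗e` coefficient of the class tensor. -/
def mu : GaussianInt := D.wch eWord

/-- positive multiplicities on the three supports. -/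
def Pos : Prop := (∀ a ∈ D.A, 0 < D.mA a) ∧ (∀ n ∈ D.N, 0 < D.mN n) ∧ ∀ c ∈ D.C, 0 < D.mC c

/-- every term, twisted by `t`, is a sum of ample boxes («`t ≥ T₁(D)`»). -/
def TermsAmpleAt (t : ℤ) : Prop := ∀ Z ∈ D.N ∪ D.A ∪ D.C, CellAmpleAt t Z

/-- all multiplicities scaled by `k` (the cell-level shadow of a `2^|F|`-fold label lift when `k = 2^|F|`). -/
def smul (k : ℤ) : BoxMonad := ⟨D.A, D.N, D.C, fun Z => k * D.mA Z, fun Z => k * D.mN Z, fun Z => k * D.mC Z⟩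

/-- the dual design (monad `C^∨ → N^∨ → A^∨`, cohomology `𝓔^∨`): inverse boxes, `A ↔ C`. -/
def dual : BoxMonad :=
  ⟨D.C.image cneg, D.N.image cneg, D.A.image cneg, fun Z => D.mC (cneg Z), fun Z => D.mN (cneg Z), fun Z => D.mA (cneg Z)⟩

end BoxMonad

theorem mass_smul (k : ℤ) (m : MCell → ℤ) (S : Finset MCell) : mass (fun Z => k * m Z) S = k * mass m S := by
  unfold mass; rw [Finset.mul_sum]

/-! ## §4 Live neighbourhoods, dead cells, plain Hall, the CLOSURE INEQUALITY (B3.2⁺) -/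

/-- `N(Γ)`: the `N`-cells with an `L`-live arc INTO some cell of the `C`-block `Γ` (feeders of `Γ`). -/
def nbC (L : MCell → MCell → Prop) [DecidableRel L] (D : BoxMonad) (Γ : Finset MCell) : Finset MCell :=
  D.N.filter fun n => ∃ c ∈ Γ, L n c

/-- `N(Γ)`: the `N`-cells receiving an `L`-live arc FROM some cell of the `A`-block `Γ` (targets of `Γ`). -/
def nbA (L : MCell → MCell → Prop) [DecidableRel L] (D : BoxMonad) (Γ : Finset MCell) : Finset MCell :=
  D.N.filter fun n => ∃ a ∈ Γ, L a n

/-- `C_{⊆U}`: the `C`-cells fed only from `U`. -/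
def belowC (L : MCell → MCell → Prop) [DecidableRel L] (D : BoxMonad) (U : Finset MCell) : Finset MCell :=
  D.C.filter fun c => ∀ n ∈ D.N, L n c → n ∈ U

/-- `A_{⊆U}`: the `A`-cells mapping only into `U`. -/
def belowA (L : MCell → MCell → Prop) [DecidableRel L] (D : BoxMonad) (U : Finset MCell) : Finset MCell :=
  D.A.filter fun a => ∀ n ∈ D.N, L a n → n ∈ U

theorem nbC_subset (L : MCell → MCell → Prop) [DecidableRel L] (D : BoxMonad) (Γ : Finset MCell) : nbC L D Γ ⊆ D.N :=
  Finset.filter_subset _ _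

theorem nbA_subset (L : MCell → MCell → Prop) [DecidableRel L] (D : BoxMonad) (Γ : Finset MCell) : nbA L D Γ ⊆ D.N :=
  Finset.filter_subset _ _

/-- more live arcs, larger neighbourhoods. -/
theorem nbC_mono {L L' : MCell → MCell → Prop} [DecidableRel L] [DecidableRel L'] (hLL : ∀ x y, L' x y → L x y)
    (D : BoxMonad) (Γ : Finset MCell) : nbC L' D Γ ⊆ nbC L D Γ := by
  intro n hn
  simp only [nbC, Finset.mem_filter] at hn ⊢
  exact ⟨hn.1, hn.2.imp fun c hc => ⟨hc.1, hLL _ _ hc.2⟩⟩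

theorem nbA_mono {L L' : MCell → MCell → Prop} [DecidableRel L] [DecidableRel L'] (hLL : ∀ x y, L' x y → L x y)
    (D : BoxMonad) (Γ : Finset MCell) : nbA L' D Γ ⊆ nbA L D Γ := by
  intro n hn
  simp only [nbA, Finset.mem_filter] at hn ⊢
  exact ⟨hn.1, hn.2.imp fun a ha => ⟨ha.1, hLL _ _ ha.2⟩⟩

theorem belowC_univ (L : MCell → MCell → Prop) [DecidableRel L] (D : BoxMonad) : belowC L D D.N = D.C :=
  Finset.filter_true_of_mem fun _ _ _ hn _ => hn

theorem belowA_univ (L : MCell → MCell → Prop) [DecidableRel L] (D : BoxMonad) : belowA L D D.N = D.A :=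
  Finset.filter_true_of_mem fun _ _ _ hn _ => hn

/-- (B3.0) DEAD CELLS: an `A`-cell with no live out-arc (`i ≡ 0` on it) or a `C`-cell with no live in-arc (`q ≡ 0` onto it). -/
def HasDeadCell (L : MCell → MCell → Prop) [DecidableRel L] (D : BoxMonad) : Prop :=
  (∃ a ∈ D.A, nbA L D {a} = ∅) ∨ ∃ c ∈ D.C, nbC L D {c} = ∅

/-- (KQ) plain DOWN-Hall: every `C`-block is fed by at least its own mass (necessary for a generically surjective `q`). -/
def HallQ (L : MCell → MCell → Prop) [DecidableRel L] (D : BoxMonad) : Prop :=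
  ∀ Γ ∈ D.C.powerset, mass D.mC Γ ≤ mass D.mN (nbC L D Γ)

/-- (KI) plain UP-Hall: every `A`-block maps into at least its own mass (necessary for a generically injective `i`). -/
def HallI (L : MCell → MCell → Prop) [DecidableRel L] (D : BoxMonad) : Prop :=
  ∀ Γ ∈ D.A.powerset, mass D.mA Γ ≤ mass D.mN (nbA L D Γ)

/-- (B3.2⁺) the CLOSURE INEQUALITY at level `t`: for every `U ⊆ N`, `w_t(C_{⊆U}) + w_t(A_{⊆U}) ≤ w_t(U)`.  Pen lemma (docstring):
at a level where all terms are ample, every monad on `D` has `h¹(𝓔(t) ⊗ α) ≥` the violated amount, for every `α` and every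
labelling; so `IT₀(𝓔(t))` needs it.  One min-cut per `t` (`b3cohom.py`). -/
def ClosureIneq (L : MCell → MCell → Prop) [DecidableRel L] (D : BoxMonad) (t : ℤ) : Prop :=
  ∀ U ∈ D.N.powerset, wOf D.mC t (belowC L D U) + wOf D.mA t (belowA L D U) ≤ wOf D.mN t U

/-- «`t` is an effective level»: the closure inequality holds from `t` on. -/
def EffectiveFrom (L : MCell → MCell → Prop) [DecidableRel L] (D : BoxMonad) (t : ℤ) : Prop :=
  ∀ t', t ≤ t' → ClosureIneq L D t'

/-- the instance `U = N` of the closure inequality is `χ_D(t) ≥ 0`. -/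
theorem chiAt_nonneg_of_closureIneq {L : MCell → MCell → Prop} [DecidableRel L] {D : BoxMonad} {t : ℤ}
    (h : ClosureIneq L D t) : 0 ≤ D.chiAt t := by
  have hU := h D.N (Finset.mem_powerset.mpr subset_rfl)
  rw [belowC_univ, belowA_univ] at hU
  unfold BoxMonad.chiAt
  linarith

/-! ## §5 Tight blocks: the Krull–Schmidt face of (B3.2♭), its class faces, strict Hall -/

/-- a multiplicity-TIGHT `C`-block: fed by exactly its own mass. -/
def TightC (L : MCell → MCell → Prop) [DecidableRel L] (D : BoxMonad) (Γ : Finset MCell) : Prop :=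
  mass D.mC Γ = mass D.mN (nbC L D Γ)

/-- a multiplicity-tight `A`-block: maps into exactly its own mass. -/
def TightA (L : MCell → MCell → Prop) [DecidableRel L] (D : BoxMonad) (Γ : Finset MCell) : Prop :=
  mass D.mA Γ = mass D.mN (nbA L D Γ)

/-- an IDENTITY `C`-block: its feeders are the same cells with the same multiplicities (a cancellable block `𝒩_{N(Γ)} ≅ 𝒞_Γ`). -/
def IdBlockC (L : MCell → MCell → Prop) [DecidableRel L] (D : BoxMonad) (Γ : Finset MCell) : Prop :=
  nbC L D Γ = Γ ∧ ∀ Z ∈ Γ, D.mN Z = D.mC Z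

/-- an identity `A`-block. -/
def IdBlockA (L : MCell → MCell → Prop) [DecidableRel L] (D : BoxMonad) (Γ : Finset MCell) : Prop :=
  nbA L D Γ = Γ ∧ ∀ Z ∈ Γ, D.mN Z = D.mA Z

/-- (B3.2♭) KRULL–SCHMIDT TIGHT-BLOCK LAW, `q`-side: every non-empty tight `C`-block is an identity block
(necessary for a surjective `q` — equal-rank surjection of bundles is an isomorphism; Atiyah's Krull–Schmidt theorem). -/
def KSTightC (L : MCell → MCell → Prop) [DecidableRel L] (D : BoxMonad) : Prop :=
  ∀ Γ ∈ D.C.powerset, Γ.Nonempty → TightC L D Γ → IdBlockC L D Γ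

/-- (B3.2♭) Krull–Schmidt tight-block law, `i`-side: every non-empty tight `A`-block is an identity block
(necessary for `i` a sub-bundle). -/
def KSTightA (L : MCell → MCell → Prop) [DecidableRel L] (D : BoxMonad) : Prop :=
  ∀ Γ ∈ D.A.powerset, Γ.Nonempty → TightA L D Γ → IdBlockA L D Γ

/-- a BAD tight `C`-block: non-empty, tight, not an identity block — a certificate that no surjective `q` exists on `D`
for any maps under any labelling whose live relation is `≤ L` (§6). -/
def BadTightC (L : MCell → MCell → Prop) [DecidableRel L] (D : BoxMonad) (Γ : Finset MCell) : Prop :=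
  Γ ⊆ D.C ∧ Γ.Nonempty ∧ TightC L D Γ ∧ ¬ IdBlockC L D Γ

/-- a bad tight `A`-block (no sub-bundle `i`). -/
def BadTightA (L : MCell → MCell → Prop) [DecidableRel L] (D : BoxMonad) (Γ : Finset MCell) : Prop :=
  Γ ⊆ D.A ∧ Γ.Nonempty ∧ TightA L D Γ ∧ ¬ IdBlockA L D Γ

/-- the FULL class-tensor defect of a `C`-block: `Σ_Γ m_C ch(c) − Σ_{N(Γ)} m_N ch(n)` (zero on an identity block). -/
def defectC (L : MCell → MCell → Prop) [DecidableRel L] (D : BoxMonad) (Γ : Finset MCell) : CWord → GaussianInt :=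
  wchOf D.mC Γ - wchOf D.mN (nbC L D Γ)

/-- the first-Chern-class face of the defect on factor `f`, in letter coordinates (`b3cohom.py`'s `delta_c1`; g0's `deltaC`):
`δ(Γ)_f = Σ_Γ m_C · (c f) − Σ_{N(Γ)} m_N · (n f)` = `c₁(det q_Γ)` on factor `f`. -/
def deltaC (L : MCell → MCell → Prop) [DecidableRel L] (D : BoxMonad) (Γ : Finset MCell) (f : Fin 4) : BPoint :=
  ((∑ c ∈ Γ, D.mC c * (c f).1) - ∑ n ∈ nbC L D Γ, D.mN n * (n f).1,
   (∑ c ∈ Γ, D.mC c * (c f).2.1) - ∑ n ∈ nbC L D Γ, D.mN n * (n f).2.1,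
   (∑ c ∈ Γ, D.mC c * (c f).2.2) - ∑ n ∈ nbC L D Γ, D.mN n * (n f).2.2)

/-- the same on the `i`-side: `Σ_{N(Γ)} m_N · (n f) − Σ_Γ m_A · (a f)`. -/
def deltaA (L : MCell → MCell → Prop) [DecidableRel L] (D : BoxMonad) (Γ : Finset MCell) (f : Fin 4) : BPoint :=
  ((∑ n ∈ nbA L D Γ, D.mN n * (n f).1) - ∑ a ∈ Γ, D.mA a * (a f).1,
   (∑ n ∈ nbA L D Γ, D.mN n * (n f).2.1) - ∑ a ∈ Γ, D.mA a * (a f).2.1,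
   (∑ n ∈ nbA L D Γ, D.mN n * (n f).2.2) - ∑ a ∈ Γ, D.mA a * (a f).2.2)

/-- g0's (B3.2♭) as typed in `B3Spec.lean` ∕ computed by `b3cohom.py`: no non-empty tight `C`-block with non-zero `c₁`-defect. -/
def NoBadTightC (L : MCell → MCell → Prop) [DecidableRel L] (D : BoxMonad) : Prop :=
  ∀ Γ ∈ D.C.powerset, Γ.Nonempty → TightC L D Γ → ∀ f, deltaC L D Γ f = (0, 0, 0)

/-- the `i`-side `c₁`-face. -/
def NoBadTightA (L : MCell → MCell → Prop) [DecidableRel L] (D : BoxMonad) : Prop :=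
  ∀ Γ ∈ D.A.powerset, Γ.Nonempty → TightA L D Γ → ∀ f, deltaA L D Γ f = (0, 0, 0)

/-- an identity block has zero `c₁`-defect on every factor. -/
theorem deltaC_eq_zero_of_idBlock {L : MCell → MCell → Prop} [DecidableRel L] {D : BoxMonad} {Γ : Finset MCell}
    (h : IdBlockC L D Γ) (f : Fin 4) : deltaC L D Γ f = (0, 0, 0) := by
  obtain ⟨hΓ, hm⟩ := h
  have e1 : ∑ c ∈ Γ, D.mC c * (c f).1 = ∑ n ∈ Γ, D.mN n * (n f).1 :=
    Finset.sum_congr rfl fun Z hZ => by rw [hm Z hZ]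
  have e2 : ∑ c ∈ Γ, D.mC c * (c f).2.1 = ∑ n ∈ Γ, D.mN n * (n f).2.1 :=
    Finset.sum_congr rfl fun Z hZ => by rw [hm Z hZ]
  have e3 : ∑ c ∈ Γ, D.mC c * (c f).2.2 = ∑ n ∈ Γ, D.mN n * (n f).2.2 :=
    Finset.sum_congr rfl fun Z hZ => by rw [hm Z hZ]
  unfold deltaC
  rw [hΓ, e1, e2, e3]
  simp

/-- an identity block has zero FULL class defect. -/
theorem defectC_eq_zero_of_idBlock {L : MCell → MCell → Prop} [DecidableRel L] {D : BoxMonad} {Γ : Finset MCell}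
    (h : IdBlockC L D Γ) : defectC L D Γ = 0 := by
  obtain ⟨hΓ, hm⟩ := h
  have e : wchOf D.mC Γ = wchOf D.mN Γ := Finset.sum_congr rfl fun Z hZ => by rw [hm Z hZ]
  unfold defectC
  rw [hΓ, e, sub_self]

/-- the Krull–Schmidt face implies g0's `c₁`-face. -/
theorem noBadTightC_of_ks {L : MCell → MCell → Prop} [DecidableRel L] {D : BoxMonad} (h : KSTightC L D) :
    NoBadTightC L D :=
  fun Γ hΓ hne ht f => deltaC_eq_zero_of_idBlock (h Γ hΓ hne ht) f

/-- a non-zero `c₁`-defect (one factor, any coordinate) on a non-empty tight block is a BAD tight block. -/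
theorem badTightC_of_deltaC_ne {L : MCell → MCell → Prop} [DecidableRel L] {D : BoxMonad} {Γ : Finset MCell}
    (hΓ : Γ ⊆ D.C) (hne : Γ.Nonempty) (ht : TightC L D Γ) {f : Fin 4} (hδ : deltaC L D Γ f ≠ (0, 0, 0)) :
    BadTightC L D Γ :=
  ⟨hΓ, hne, ht, fun hid => hδ (deltaC_eq_zero_of_idBlock hid f)⟩

/-- STRICT DOWN-Hall: surplus `≥ 1` on every non-empty `C`-block. -/
def StrictHallQ (L : MCell → MCell → Prop) [DecidableRel L] (D : BoxMonad) : Prop :=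
  ∀ Γ ∈ D.C.powerset, Γ.Nonempty → mass D.mC Γ < mass D.mN (nbC L D Γ)

/-- STRICT UP-Hall. -/
def StrictHallI (L : MCell → MCell → Prop) [DecidableRel L] (D : BoxMonad) : Prop :=
  ∀ Γ ∈ D.A.powerset, Γ.Nonempty → mass D.mA Γ < mass D.mN (nbA L D Γ)

theorem hallQ_of_strict {L : MCell → MCell → Prop} [DecidableRel L] {D : BoxMonad} (h : StrictHallQ L D) : HallQ L D := by
  intro Γ hΓ
  rcases Γ.eq_empty_or_nonempty with rfl | hne
  · simp [mass, nbC]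
  · exact (h Γ hΓ hne).le

theorem ks_of_strict {L : MCell → MCell → Prop} [DecidableRel L] {D : BoxMonad} (h : StrictHallQ L D) : KSTightC L D :=
  fun Γ hΓ hne ht => absurd ht (h Γ hΓ hne).ne

/-- when the `N`-level and the `C`-level share no cell, «Hall ∧ Krull–Schmidt» on the `q`-side IS strict Hall. -/
theorem strictHallQ_of_disjoint {L : MCell → MCell → Prop} [DecidableRel L] {D : BoxMonad} (hd : Disjoint D.N D.C)
    (hH : HallQ L D) (hK : KSTightC L D) : StrictHallQ L D := by
  intro Γ hΓ hne
  rcases (hH Γ hΓ).lt_or_eq with hlt | heq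
  · exact hlt
  · exfalso
    obtain ⟨hid, -⟩ := hK Γ hΓ hne heq
    obtain ⟨z, hz⟩ := hne
    have hz' : z ∈ nbC L D Γ := by rw [hid]; exact hz
    exact Finset.disjoint_left.mp hd (nbC_subset L D Γ hz') (Finset.mem_powerset.mp hΓ hz)

/-! ## §6 Labelling-blindness (arc monotonicity) and scaling of the tight-block row; the lift corollary -/

/-- a sub-family of a positively weighted family with at least the whole mass is the whole family. -/
theorem eq_of_subset_of_sum_le {s t : Finset MCell} {f : MCell → ℤ} (hst : s ⊆ t) (hpos : ∀ i ∈ t, 0 < f i)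
    (hle : ∑ i ∈ t, f i ≤ ∑ i ∈ s, f i) : s = t := by
  by_contra hne
  obtain ⟨i, hit, his⟩ := Finset.exists_of_ssubset (lt_of_le_of_ne hst hne)
  have := Finset.sum_lt_sum_of_subset hst hit his (hpos i hit) fun j hj _ => (hpos j hj).le
  linarith

/-- ARC MONOTONICITY of the tight-block row (`q`-side).  If `Γ` is a BAD tight `C`-block for the live relation `L` and the
`N`-multiplicities are positive, then under EVERY sub-relation `L′ ≤ L` (fewer live arcs: any labelling) the design violates
«HallQ ∧ KSTightC»: either `Γ` is no longer fed by its mass, or it is still tight with the same feeders and still not an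
identity block.  (The plain-Hall half is colour-1's `ColourForgetHall.hall_mono_arcs`; this is the tight half.) -/
theorem not_hallKS_of_badTightC {L L' : MCell → MCell → Prop} [DecidableRel L] [DecidableRel L']
    (hLL : ∀ x y, L' x y → L x y) {D : BoxMonad} (hpos : ∀ n ∈ D.N, 0 < D.mN n) {Γ : Finset MCell}
    (hbad : BadTightC L D Γ) : ¬ (HallQ L' D ∧ KSTightC L' D) := by
  rintro ⟨hH, hK⟩
  obtain ⟨hΓC, hne, htight, hnid⟩ := hbad
  have hΓ : Γ ∈ D.C.powerset := Finset.mem_powerset.mpr hΓC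
  have hsub : nbC L' D Γ ⊆ nbC L D Γ := nbC_mono hLL D Γ
  have h1 : mass D.mC Γ ≤ mass D.mN (nbC L' D Γ) := hH Γ hΓ
  have h2 : mass D.mN (nbC L D Γ) ≤ mass D.mN (nbC L' D Γ) := by unfold TightC at htight; linarith
  have heq : nbC L' D Γ = nbC L D Γ :=
    eq_of_subset_of_sum_le hsub (fun i hi => hpos i (nbC_subset L D Γ hi)) h2
  have htight' : TightC L' D Γ := by unfold TightC at htight ⊢; rw [heq]; exact htight
  have hid' := hK Γ hΓ hne htight'
  apply hnid
  unfold IdBlockC at hid' ⊢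
  rw [← heq]
  exact hid'

/-- the `i`-side twin. -/
theorem not_hallKS_of_badTightA {L L' : MCell → MCell → Prop} [DecidableRel L] [DecidableRel L']
    (hLL : ∀ x y, L' x y → L x y) {D : BoxMonad} (hpos : ∀ n ∈ D.N, 0 < D.mN n) {Γ : Finset MCell}
    (hbad : BadTightA L D Γ) : ¬ (HallI L' D ∧ KSTightA L' D) := by
  rintro ⟨hH, hK⟩
  obtain ⟨hΓA, hne, htight, hnid⟩ := hbad
  have hΓ : Γ ∈ D.A.powerset := Finset.mem_powerset.mpr hΓA
  have hsub : nbA L' D Γ ⊆ nbA L D Γ := nbA_mono hLL D Γ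
  have h1 : mass D.mA Γ ≤ mass D.mN (nbA L' D Γ) := hH Γ hΓ
  have h2 : mass D.mN (nbA L D Γ) ≤ mass D.mN (nbA L' D Γ) := by unfold TightA at htight; linarith
  have heq : nbA L' D Γ = nbA L D Γ :=
    eq_of_subset_of_sum_le hsub (fun i hi => hpos i (nbA_subset L D Γ hi)) h2
  have htight' : TightA L' D Γ := by unfold TightA at htight ⊢; rw [heq]; exact htight
  have hid' := hK Γ hΓ hne htight'
  apply hnid
  unfold IdBlockA at hid' ⊢
  rw [← heq]
  exact hid'

theorem nbC_smul (L : MCell → MCell → Prop) [DecidableRel L] (k : ℤ) (D : BoxMonad) (Γ : Finset MCell) :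
    nbC L (D.smul k) Γ = nbC L D Γ := rfl

theorem nbA_smul (L : MCell → MCell → Prop) [DecidableRel L] (k : ℤ) (D : BoxMonad) (Γ : Finset MCell) :
    nbA L (D.smul k) Γ = nbA L D Γ := rfl

/-- SCALING: tightness is homogeneous in the multiplicities. -/
theorem tightC_smul_iff (L : MCell → MCell → Prop) [DecidableRel L] {k : ℤ} (hk : k ≠ 0) (D : BoxMonad) (Γ : Finset MCell) :
    TightC L (D.smul k) Γ ↔ TightC L D Γ := by
  show mass (fun Z => k * D.mC Z) Γ = mass (fun Z => k * D.mN Z) (nbC L D Γ) ↔ mass D.mC Γ = mass D.mN (nbC L D Γ)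
  rw [mass_smul, mass_smul]
  exact ⟨fun h => mul_left_cancel₀ hk h, fun h => by rw [h]⟩

theorem idBlockC_smul_iff (L : MCell → MCell → Prop) [DecidableRel L] {k : ℤ} (hk : k ≠ 0) (D : BoxMonad) (Γ : Finset MCell) :
    IdBlockC L (D.smul k) Γ ↔ IdBlockC L D Γ := by
  show (nbC L D Γ = Γ ∧ ∀ Z ∈ Γ, k * D.mN Z = k * D.mC Z) ↔ (nbC L D Γ = Γ ∧ ∀ Z ∈ Γ, D.mN Z = D.mC Z)
  exact ⟨fun h => ⟨h.1, fun Z hZ => mul_left_cancel₀ hk (h.2 Z hZ)⟩, fun h => ⟨h.1, fun Z hZ => by rw [h.2 Z hZ]⟩⟩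

/-- SCALING: bad tight blocks of `k·D` and of `D` are the same blocks (`k ≠ 0`). -/
theorem badTightC_smul_iff (L : MCell → MCell → Prop) [DecidableRel L] {k : ℤ} (hk : k ≠ 0) (D : BoxMonad) (Γ : Finset MCell) :
    BadTightC L (D.smul k) Γ ↔ BadTightC L D Γ := by
  unfold BadTightC
  rw [tightC_smul_iff L hk, idBlockC_smul_iff L hk]
  exact Iff.rfl

/-- THE LIFT COROLLARY (director-hodge R19.341's prediction «lifts of tight-block-dead designs stay dead», cell level; the
kill-free `k_min = 0 ⇒ k_min♯ = 0` half of bc5-plan g14's SANDWICH is the class-level statement of record): a bad tight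
`C`-block of `D` for the relation OF RECORD `MCell.le` kills «HallQ ∧ KSTightC» for every positive multiple `k·D` under every
sub-relation `L′ ≤ MCell.le` — in particular for the coarsening `(L♯, 2^|F|·D)` of the canonical τ-lift `D♯_F`. -/
theorem lift_inherits_badTightC {L' : MCell → MCell → Prop} [DecidableRel L'] (hL' : ∀ x y, L' x y → MCell.le x y)
    {D : BoxMonad} (hpos : ∀ n ∈ D.N, 0 < D.mN n) {k : ℤ} (hk : 0 < k) {Γ : Finset MCell}
    (hbad : BadTightC MCell.le D Γ) : ¬ (HallQ L' (D.smul k) ∧ KSTightC L' (D.smul k)) :=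
  not_hallKS_of_badTightC hL' (D := D.smul k) (fun n hn => mul_pos hk (hpos n hn))
    ((badTightC_smul_iff MCell.le hk.ne' D Γ).mpr hbad)

/-! ### §6b The same two laws for the closure inequality (B3.2⁺) -/

/-- fewer live arcs, more cells fed only from `U`. -/
theorem belowC_anti {L L' : MCell → MCell → Prop} [DecidableRel L] [DecidableRel L'] (hLL : ∀ x y, L' x y → L x y)
    (D : BoxMonad) (U : Finset MCell) : belowC L D U ⊆ belowC L' D U := by
  intro c hc
  simp only [belowC, Finset.mem_filter] at hc ⊢
  exact ⟨hc.1, fun n hn h' => hc.2 n hn (hLL _ _ h')⟩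

theorem belowA_anti {L L' : MCell → MCell → Prop} [DecidableRel L] [DecidableRel L'] (hLL : ∀ x y, L' x y → L x y)
    (D : BoxMonad) (U : Finset MCell) : belowA L D U ⊆ belowA L' D U := by
  intro a ha
  simp only [belowA, Finset.mem_filter] at ha ⊢
  exact ⟨ha.1, fun n hn h' => ha.2 n hn (hLL _ _ h')⟩

/-- ARC MONOTONICITY of (B3.2⁺): with non-negative weights on the `A`- and `C`-cells, the closure inequality for a
sub-relation `L′ ≤ L` implies the one for `L` — so a violation for the relation of record is a violation for every labelling. -/
theorem closureIneq_of_sub {L L' : MCell → MCell → Prop} [DecidableRel L] [DecidableRel L'] (hLL : ∀ x y, L' x y → L x y)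
    {D : BoxMonad} {t : ℤ} (hC : ∀ c ∈ D.C, 0 ≤ D.mC c * cellW t c) (hA : ∀ a ∈ D.A, 0 ≤ D.mA a * cellW t a)
    (h : ClosureIneq L' D t) : ClosureIneq L D t := by
  intro U hU
  have h' := h U hU
  have e1 : wOf D.mC t (belowC L D U) ≤ wOf D.mC t (belowC L' D U) :=
    Finset.sum_le_sum_of_subset_of_nonneg (belowC_anti hLL D U) fun c hc _ => hC c (Finset.mem_filter.mp hc).1
  have e2 : wOf D.mA t (belowA L D U) ≤ wOf D.mA t (belowA L' D U) :=
    Finset.sum_le_sum_of_subset_of_nonneg (belowA_anti hLL D U) fun a ha _ => hA a (Finset.mem_filter.mp ha).1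
  linarith

theorem wOf_smul (k : ℤ) (m : MCell → ℤ) (t : ℤ) (S : Finset MCell) :
    wOf (fun Z => k * m Z) t S = k * wOf m t S := by
  unfold wOf
  rw [Finset.mul_sum]
  exact Finset.sum_congr rfl fun _ _ => by ring

/-- SCALING of (B3.2⁺): the closure inequality is homogeneous in the multiplicities (`k > 0`). -/
theorem closureIneq_smul_iff (L : MCell → MCell → Prop) [DecidableRel L] {k : ℤ} (hk : 0 < k) (D : BoxMonad) (t : ℤ) :
    ClosureIneq L (D.smul k) t ↔ ClosureIneq L D t := by
  show (∀ U ∈ D.N.powerset, wOf (fun Z => k * D.mC Z) t (belowC L D U) + wOf (fun Z => k * D.mA Z) t (belowA L D U) ≤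
      wOf (fun Z => k * D.mN Z) t U) ↔ _
  refine forall₂_congr fun U _ => ?_
  rw [wOf_smul, wOf_smul, wOf_smul, ← mul_add]
  exact ⟨fun h => le_of_mul_le_mul_left h hk, fun h => mul_le_mul_of_nonneg_left h hk.le⟩

/-- THE LIFT COROLLARY for (B3.2⁺): a closure violation of `D` at level `t` for the relation of record (non-negative weights)
is a closure violation of every positive multiple `k·D` under every labelling `L′ ≤ MCell.le`. -/
theorem lift_inherits_closure_violation {L' : MCell → MCell → Prop} [DecidableRel L'] (hL' : ∀ x y, L' x y → MCell.le x y)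
    {D : BoxMonad} {t : ℤ} (hC : ∀ c ∈ D.C, 0 ≤ D.mC c * cellW t c) (hA : ∀ a ∈ D.A, 0 ≤ D.mA a * cellW t a)
    {k : ℤ} (hk : 0 < k) (h : ¬ ClosureIneq MCell.le D t) : ¬ ClosureIneq L' (D.smul k) t := by
  intro h'
  have hC' : ∀ c ∈ (D.smul k).C, 0 ≤ (D.smul k).mC c * cellW t c := fun c hc => by
    show 0 ≤ k * D.mC c * cellW t c
    rw [mul_assoc]; exact mul_nonneg hk.le (hC c hc)
  have hA' : ∀ a ∈ (D.smul k).A, 0 ≤ (D.smul k).mA a * cellW t a := fun a ha => by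
    show 0 ≤ k * D.mA a * cellW t a
    rw [mul_assoc]; exact mul_nonneg hk.le (hA a ha)
  exact h ((closureIneq_smul_iff MCell.le hk D t).mp (closureIneq_of_sub hL' hC' hA' h'))

/-! ### §6c The maximal tight block: tight blocks form a lattice, so ONE block decides the Krull–Schmidt row

Pen lemma P3 of the memo, kernel part.  Under plain Hall the multiplicity-tight `C`-blocks are closed under union
(submodularity of `Γ ↦ m_N(N(Γ)) − m_C(Γ)`), hence their union `tightUnionC` is the MAXIMAL tight block; for a REFLEXIVE live
relation (`MCell.le` is) and positive `N`-multiplicities the Krull–Schmidt law `KSTightC` holds iff that one block is an identity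
block (the empty block counts as identity).  The max-flow scan `tightscan.py` prints exactly this block (the `C`-cells on the sink
side of the canonical minimum cut) and tests identity; the identification «sink side of the canonical min cut = union of all tight
blocks» is max-flow∕min-cut theory (pen), everything else below is kernel.  `A`-side twins follow the `C`-side statements. -/

theorem mCell_le_refl (Z : MCell) : MCell.le Z Z := fun f => by norm_num [Effective, bsub]

theorem nbC_union (L : MCell → MCell → Prop) [DecidableRel L] (D : BoxMonad) (Γ₁ Γ₂ : Finset MCell) :
    nbC L D (Γ₁ ∪ Γ₂) = nbC L D Γ₁ ∪ nbC L D Γ₂ := by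
  ext n
  simp only [nbC, Finset.mem_filter, Finset.mem_union]
  constructor
  · rintro ⟨hn, c, hc | hc, hl⟩
    · exact Or.inl ⟨hn, c, hc, hl⟩
    · exact Or.inr ⟨hn, c, hc, hl⟩
  · rintro (⟨hn, c, hc, hl⟩ | ⟨hn, c, hc, hl⟩)
    · exact ⟨hn, c, Or.inl hc, hl⟩
    · exact ⟨hn, c, Or.inr hc, hl⟩

theorem nbA_union (L : MCell → MCell → Prop) [DecidableRel L] (D : BoxMonad) (Γ₁ Γ₂ : Finset MCell) :
    nbA L D (Γ₁ ∪ Γ₂) = nbA L D Γ₁ ∪ nbA L D Γ₂ := by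
  ext n
  simp only [nbA, Finset.mem_filter, Finset.mem_union]
  constructor
  · rintro ⟨hn, a, ha | ha, hl⟩
    · exact Or.inl ⟨hn, a, ha, hl⟩
    · exact Or.inr ⟨hn, a, ha, hl⟩
  · rintro (⟨hn, a, ha, hl⟩ | ⟨hn, a, ha, hl⟩)
    · exact ⟨hn, a, Or.inl ha, hl⟩
    · exact ⟨hn, a, Or.inr ha, hl⟩

theorem nbC_inter_subset (L : MCell → MCell → Prop) [DecidableRel L] (D : BoxMonad) (Γ₁ Γ₂ : Finset MCell) :
    nbC L D (Γ₁ ∩ Γ₂) ⊆ nbC L D Γ₁ ∩ nbC L D Γ₂ := by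
  intro n hn
  simp only [nbC, Finset.mem_filter, Finset.mem_inter] at hn ⊢
  obtain ⟨hn, c, ⟨h₁, h₂⟩, hl⟩ := hn
  exact ⟨⟨hn, c, h₁, hl⟩, ⟨hn, c, h₂, hl⟩⟩

theorem nbA_inter_subset (L : MCell → MCell → Prop) [DecidableRel L] (D : BoxMonad) (Γ₁ Γ₂ : Finset MCell) :
    nbA L D (Γ₁ ∩ Γ₂) ⊆ nbA L D Γ₁ ∩ nbA L D Γ₂ := by
  intro n hn
  simp only [nbA, Finset.mem_filter, Finset.mem_inter] at hn ⊢
  obtain ⟨hn, a, ⟨h₁, h₂⟩, hl⟩ := hn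
  exact ⟨⟨hn, a, h₁, hl⟩, ⟨hn, a, h₂, hl⟩⟩

theorem mass_union_inter (m : MCell → ℤ) (S T : Finset MCell) : mass m (S ∪ T) + mass m (S ∩ T) = mass m S + mass m T := by
  unfold mass; exact Finset.sum_union_inter

/-- SUBMODULARITY ⇒ UNION CLOSURE: under plain Hall (and `m_N ≥ 0`) the union of two tight `C`-blocks is tight. -/
theorem tightC_union {L : MCell → MCell → Prop} [DecidableRel L] {D : BoxMonad} (hH : HallQ L D)
    (hN : ∀ n ∈ D.N, 0 ≤ D.mN n) {Γ₁ Γ₂ : Finset MCell} (h₁ : Γ₁ ⊆ D.C) (h₂ : Γ₂ ⊆ D.C)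
    (t₁ : TightC L D Γ₁) (t₂ : TightC L D Γ₂) : TightC L D (Γ₁ ∪ Γ₂) := by
  have hI : mass D.mC (Γ₁ ∩ Γ₂) ≤ mass D.mN (nbC L D (Γ₁ ∩ Γ₂)) :=
    hH _ (Finset.mem_powerset.mpr (Finset.inter_subset_left.trans h₁))
  have hU : mass D.mC (Γ₁ ∪ Γ₂) ≤ mass D.mN (nbC L D (Γ₁ ∪ Γ₂)) :=
    hH _ (Finset.mem_powerset.mpr (Finset.union_subset h₁ h₂))
  have eC := mass_union_inter D.mC Γ₁ Γ₂
  have eN := mass_union_inter D.mN (nbC L D Γ₁) (nbC L D Γ₂)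
  have hsub : mass D.mN (nbC L D (Γ₁ ∩ Γ₂)) ≤ mass D.mN (nbC L D Γ₁ ∩ nbC L D Γ₂) :=
    Finset.sum_le_sum_of_subset_of_nonneg (nbC_inter_subset L D Γ₁ Γ₂)
      fun n hn _ => hN n (nbC_subset L D Γ₁ (Finset.mem_inter.mp hn).1)
  unfold TightC at t₁ t₂ ⊢
  rw [nbC_union] at hU ⊢
  linarith

/-- union closure of tight `A`-blocks. -/
theorem tightA_union {L : MCell → MCell → Prop} [DecidableRel L] {D : BoxMonad} (hH : HallI L D)
    (hN : ∀ n ∈ D.N, 0 ≤ D.mN n) {Γ₁ Γ₂ : Finset MCell} (h₁ : Γ₁ ⊆ D.A) (h₂ : Γ₂ ⊆ D.A)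
    (t₁ : TightA L D Γ₁) (t₂ : TightA L D Γ₂) : TightA L D (Γ₁ ∪ Γ₂) := by
  have hI : mass D.mA (Γ₁ ∩ Γ₂) ≤ mass D.mN (nbA L D (Γ₁ ∩ Γ₂)) :=
    hH _ (Finset.mem_powerset.mpr (Finset.inter_subset_left.trans h₁))
  have hU : mass D.mA (Γ₁ ∪ Γ₂) ≤ mass D.mN (nbA L D (Γ₁ ∪ Γ₂)) :=
    hH _ (Finset.mem_powerset.mpr (Finset.union_subset h₁ h₂))
  have eA := mass_union_inter D.mA Γ₁ Γ₂
  have eN := mass_union_inter D.mN (nbA L D Γ₁) (nbA L D Γ₂)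
  have hsub : mass D.mN (nbA L D (Γ₁ ∩ Γ₂)) ≤ mass D.mN (nbA L D Γ₁ ∩ nbA L D Γ₂) :=
    Finset.sum_le_sum_of_subset_of_nonneg (nbA_inter_subset L D Γ₁ Γ₂)
      fun n hn _ => hN n (nbA_subset L D Γ₁ (Finset.mem_inter.mp hn).1)
  unfold TightA at t₁ t₂ ⊢
  rw [nbA_union] at hU ⊢
  linarith

/-- the union of ALL tight `C`-blocks (the tightness test is `TightC`, spelled out so that `filter` finds its decidability). -/
def tightUnionC (L : MCell → MCell → Prop) [DecidableRel L] (D : BoxMonad) : Finset MCell :=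
  (D.C.powerset.filter fun Γ => mass D.mC Γ = mass D.mN (nbC L D Γ)).sup id

/-- the union of all tight `A`-blocks. -/
def tightUnionA (L : MCell → MCell → Prop) [DecidableRel L] (D : BoxMonad) : Finset MCell :=
  (D.A.powerset.filter fun Γ => mass D.mA Γ = mass D.mN (nbA L D Γ)).sup id

theorem subset_tightUnionC {L : MCell → MCell → Prop} [DecidableRel L] {D : BoxMonad} {Γ : Finset MCell}
    (hΓ : Γ ⊆ D.C) (ht : TightC L D Γ) : Γ ⊆ tightUnionC L D :=
  Finset.le_sup (f := id) (Finset.mem_filter.mpr ⟨Finset.mem_powerset.mpr hΓ, ht⟩)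

theorem subset_tightUnionA {L : MCell → MCell → Prop} [DecidableRel L] {D : BoxMonad} {Γ : Finset MCell}
    (hΓ : Γ ⊆ D.A) (ht : TightA L D Γ) : Γ ⊆ tightUnionA L D :=
  Finset.le_sup (f := id) (Finset.mem_filter.mpr ⟨Finset.mem_powerset.mpr hΓ, ht⟩)

theorem tightUnionC_subset (L : MCell → MCell → Prop) [DecidableRel L] (D : BoxMonad) : tightUnionC L D ⊆ D.C :=
  Finset.sup_le fun _ hΓ => Finset.mem_powerset.mp (Finset.mem_filter.mp hΓ).1

theorem tightUnionA_subset (L : MCell → MCell → Prop) [DecidableRel L] (D : BoxMonad) : tightUnionA L D ⊆ D.A :=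
  Finset.sup_le fun _ hΓ => Finset.mem_powerset.mp (Finset.mem_filter.mp hΓ).1

/-- under plain Hall the union of all tight `C`-blocks is itself tight: the MAXIMAL tight block. -/
theorem tightUnionC_tight {L : MCell → MCell → Prop} [DecidableRel L] {D : BoxMonad} (hH : HallQ L D)
    (hN : ∀ n ∈ D.N, 0 ≤ D.mN n) : TightC L D (tightUnionC L D) := by
  refine (Finset.sup_induction (p := fun Γ => Γ ⊆ D.C ∧ TightC L D Γ) ?_ ?_ ?_).2
  · exact ⟨Finset.empty_subset _, by unfold TightC; simp [mass, nbC]⟩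
  · rintro Γ₁ ⟨h₁, t₁⟩ Γ₂ ⟨h₂, t₂⟩
    exact ⟨Finset.union_subset h₁ h₂, tightC_union hH hN h₁ h₂ t₁ t₂⟩
  · intro Γ hΓ
    obtain ⟨hp, ht⟩ := Finset.mem_filter.mp hΓ
    exact ⟨Finset.mem_powerset.mp hp, ht⟩

theorem tightUnionA_tight {L : MCell → MCell → Prop} [DecidableRel L] {D : BoxMonad} (hH : HallI L D)
    (hN : ∀ n ∈ D.N, 0 ≤ D.mN n) : TightA L D (tightUnionA L D) := by
  refine (Finset.sup_induction (p := fun Γ => Γ ⊆ D.A ∧ TightA L D Γ) ?_ ?_ ?_).2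
  · exact ⟨Finset.empty_subset _, by unfold TightA; simp [mass, nbA]⟩
  · rintro Γ₁ ⟨h₁, t₁⟩ Γ₂ ⟨h₂, t₂⟩
    exact ⟨Finset.union_subset h₁ h₂, tightA_union hH hN h₁ h₂ t₁ t₂⟩
  · intro Γ hΓ
    obtain ⟨hp, ht⟩ := Finset.mem_filter.mp hΓ
    exact ⟨Finset.mem_powerset.mp hp, ht⟩

/-- ONE BLOCK DECIDES (⇐): for a reflexive live relation and positive `N`-multiplicities, if the union of all tight
`C`-blocks is an identity block then EVERY non-empty tight `C`-block is an identity block (`KSTightC`).  No Hall hypothesis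
is needed in this direction. -/
theorem ks_of_tightUnionC_id {L : MCell → MCell → Prop} [DecidableRel L] {D : BoxMonad} (hrefl : ∀ Z, L Z Z)
    (hpos : ∀ n ∈ D.N, 0 < D.mN n) (hid : IdBlockC L D (tightUnionC L D)) : KSTightC L D := by
  intro Γ hΓ _ ht
  obtain ⟨hidN, hidm⟩ := hid
  have hsub : Γ ⊆ tightUnionC L D := subset_tightUnionC (Finset.mem_powerset.mp hΓ) ht
  have hΓN : Γ ⊆ D.N := fun c hc => by
    have h' : c ∈ nbC L D (tightUnionC L D) := by rw [hidN]; exact hsub hc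
    exact nbC_subset L D _ h'
  have hself : Γ ⊆ nbC L D Γ := fun c hc => by
    simp only [nbC, Finset.mem_filter]
    exact ⟨hΓN hc, c, hc, hrefl c⟩
  have hm : mass D.mN Γ = mass D.mC Γ := Finset.sum_congr rfl fun Z hZ => hidm Z (hsub hZ)
  have hle : mass D.mN (nbC L D Γ) ≤ mass D.mN Γ := by unfold TightC at ht; linarith
  have heq : Γ = nbC L D Γ := eq_of_subset_of_sum_le hself (fun n hn => hpos n (nbC_subset L D Γ hn)) hle
  exact ⟨heq.symm, fun Z hZ => hidm Z (hsub hZ)⟩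

theorem ks_of_tightUnionA_id {L : MCell → MCell → Prop} [DecidableRel L] {D : BoxMonad} (hrefl : ∀ Z, L Z Z)
    (hpos : ∀ n ∈ D.N, 0 < D.mN n) (hid : IdBlockA L D (tightUnionA L D)) : KSTightA L D := by
  intro Γ hΓ _ ht
  obtain ⟨hidN, hidm⟩ := hid
  have hsub : Γ ⊆ tightUnionA L D := subset_tightUnionA (Finset.mem_powerset.mp hΓ) ht
  have hΓN : Γ ⊆ D.N := fun a ha => by
    have h' : a ∈ nbA L D (tightUnionA L D) := by rw [hidN]; exact hsub ha
    exact nbA_subset L D _ h'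
  have hself : Γ ⊆ nbA L D Γ := fun a ha => by
    simp only [nbA, Finset.mem_filter]
    exact ⟨hΓN ha, a, ha, hrefl a⟩
  have hm : mass D.mN Γ = mass D.mA Γ := Finset.sum_congr rfl fun Z hZ => hidm Z (hsub hZ)
  have hle : mass D.mN (nbA L D Γ) ≤ mass D.mN Γ := by unfold TightA at ht; linarith
  have heq : Γ = nbA L D Γ := eq_of_subset_of_sum_le hself (fun n hn => hpos n (nbA_subset L D Γ hn)) hle
  exact ⟨heq.symm, fun Z hZ => hidm Z (hsub hZ)⟩

/-- ONE BLOCK DECIDES (⇒): under plain Hall, `KSTightC` makes the maximal tight block an identity block. -/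
theorem tightUnionC_id_of_ks {L : MCell → MCell → Prop} [DecidableRel L] {D : BoxMonad} (hH : HallQ L D)
    (hN : ∀ n ∈ D.N, 0 ≤ D.mN n) (hK : KSTightC L D) : IdBlockC L D (tightUnionC L D) := by
  rcases (tightUnionC L D).eq_empty_or_nonempty with h0 | hne
  · refine ⟨?_, fun Z hZ => ?_⟩
    · rw [h0]; ext n; simp [nbC]
    · rw [h0] at hZ; simp at hZ
  · exact hK _ (Finset.mem_powerset.mpr (tightUnionC_subset L D)) hne (tightUnionC_tight hH hN)

theorem tightUnionA_id_of_ks {L : MCell → MCell → Prop} [DecidableRel L] {D : BoxMonad} (hH : HallI L D)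
    (hN : ∀ n ∈ D.N, 0 ≤ D.mN n) (hK : KSTightA L D) : IdBlockA L D (tightUnionA L D) := by
  rcases (tightUnionA L D).eq_empty_or_nonempty with h0 | hne
  · refine ⟨?_, fun Z hZ => ?_⟩
    · rw [h0]; ext n; simp [nbA]
    · rw [h0] at hZ; simp at hZ
  · exact hK _ (Finset.mem_powerset.mpr (tightUnionA_subset L D)) hne (tightUnionA_tight hH hN)

/-- THE KS ROW IS ONE IDENTITY TEST (pen lemma P3, kernel form): for a reflexive live relation, positive `N`-multiplicities
and plain Hall, the Krull–Schmidt tight-block law on the `q`-side holds iff the maximal tight `C`-block is an identity block. -/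
theorem ks_iff_tightUnionC_id {L : MCell → MCell → Prop} [DecidableRel L] {D : BoxMonad} (hrefl : ∀ Z, L Z Z)
    (hpos : ∀ n ∈ D.N, 0 < D.mN n) (hH : HallQ L D) : KSTightC L D ↔ IdBlockC L D (tightUnionC L D) :=
  ⟨tightUnionC_id_of_ks hH fun n hn => (hpos n hn).le, ks_of_tightUnionC_id hrefl hpos⟩

theorem ks_iff_tightUnionA_id {L : MCell → MCell → Prop} [DecidableRel L] {D : BoxMonad} (hrefl : ∀ Z, L Z Z)
    (hpos : ∀ n ∈ D.N, 0 < D.mN n) (hH : HallI L D) : KSTightA L D ↔ IdBlockA L D (tightUnionA L D) :=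
  ⟨tightUnionA_id_of_ks hH fun n hn => (hpos n hn).le, ks_of_tightUnionA_id hrefl hpos⟩

/-- the relation of record is reflexive, so on it the KS row is the one identity test. -/
theorem ks_iff_tightUnionC_id_le {D : BoxMonad} (hpos : ∀ n ∈ D.N, 0 < D.mN n) (hH : HallQ MCell.le D) :
    KSTightC MCell.le D ↔ IdBlockC MCell.le D (tightUnionC MCell.le D) :=
  ks_iff_tightUnionC_id mCell_le_refl hpos hH

theorem ks_iff_tightUnionA_id_le {D : BoxMonad} (hpos : ∀ n ∈ D.N, 0 < D.mN n) (hH : HallI MCell.le D) :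
    KSTightA MCell.le D ↔ IdBlockA MCell.le D (tightUnionA MCell.le D) :=
  ks_iff_tightUnionA_id mCell_le_refl hpos hH

/-! ## §7 «(B3) holds at level t» -/

/-- (B3) at level `t` for the live relation `L`: all terms ample at `t` (`t ≥ T₁`), no dead cell, the Krull–Schmidt tight-block
law on both sides, and the closure inequality at `t`.  Pen reading: necessary for a monad on `D` with `i` a sub-bundle, `q`
onto and `𝓔(t)` `IT₀`; conjuncts 2–4 are necessary for the display to exist at all. -/
def B3 (L : MCell → MCell → Prop) [DecidableRel L] (D : BoxMonad) (t : ℤ) : Prop :=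
  D.TermsAmpleAt t ∧ ¬ HasDeadCell L D ∧ KSTightC L D ∧ KSTightA L D ∧ ClosureIneq L D t

theorem noBadTight_of_B3 {L : MCell → MCell → Prop} [DecidableRel L] {D : BoxMonad} {t : ℤ} (h : B3 L D t) :
    NoBadTightC L D ∧ 0 ≤ D.chiAt t :=
  ⟨noBadTightC_of_ks h.2.2.1, chiAt_nonneg_of_closureIneq h.2.2.2.2⟩

/-! ## §8 Kernel toy: the ac808a66 square-fed tight pair (g0 memo §3a; monad-1 f6b5677c §3a), in the coordinates of record -/

/-- the `C`-cell `([11,0,−3] | [13,0,−1] | [13,0,−1] | [14,0,0])` of ac808a66 (`m = 286`). -/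
def cCell : MCell := mcellOf (11, 0, -3) (13, 0, -1) (13, 0, -1) (14, 0, 0)

/-- its unique live feeder `([11,0,−3] | [12,0,−2] | [12,0,−2] | [14,0,0])` (`m = 286`). -/
def nCell : MCell := mcellOf (11, 0, -3) (12, 0, -2) (12, 0, -2) (14, 0, 0)

/-- the arc `n → c` is live for the relation of record (two null steps `(1,0,1)`, two zero differences) … -/
theorem nCell_le_cCell : MCell.le nCell cCell := by decide

/-- … and the reverse arc is not. -/
theorem not_cCell_le_nCell : ¬ MCell.le cCell nCell := by decide

/-- the pen check of g0 memo §3a, kernel-checked: `w_t(c) − w_t(n) = ((11+t)² − 9)·(14+t)²·(2t+28)·(2t²+50t+308)`. -/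
theorem w_gap_factor (t : ℤ) :
    cellW t cCell - cellW t nCell =
      ((11 + t) ^ 2 - 9) * (14 + t) ^ 2 * (2 * t + 28) * (2 * t ^ 2 + 50 * t + 308) := by
  simp [cellW, Fin.prod_univ_four, cCell, nCell, mcellOf, bnormAt]
  ring

/-- hence `w_t(n) < w_t(c)` at every level `t ≥ 0`. -/
theorem w_gap_pos (t : ℤ) (ht : 0 ≤ t) : cellW t nCell < cellW t cCell := by
  have h := w_gap_factor t
  have h1 : 0 < (11 + t) ^ 2 - 9 := by nlinarith
  have h2 : 0 < (14 + t) ^ 2 := by positivity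
  have h3 : 0 < 2 * t + 28 := by linarith
  have h4 : 0 < 2 * t ^ 2 + 50 * t + 308 := by positivity
  have : 0 < cellW t cCell - cellW t nCell := by rw [h]; positivity
  linarith

/-- `w_t` of an explicit cell, letter by letter. -/
theorem cellW_mcellOf (t : ℤ) (a b c d : BPoint) :
    cellW t (mcellOf a b c d) = bnormAt t a * bnormAt t b * bnormAt t c * bnormAt t d := by
  simp [cellW, Fin.prod_univ_four, mcellOf]

/-- `w_t(c) = ((11+t)² − 9)·((13+t)² − 1)²·(14+t)²`. -/
theorem cellW_cCell (t : ℤ) : cellW t cCell = ((11 + t) ^ 2 - 9) * ((13 + t) ^ 2 - 1) ^ 2 * (14 + t) ^ 2 := by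
  rw [cCell, cellW_mcellOf]
  simp only [bnormAt]
  ring

theorem cellW_cCell_nonneg (t : ℤ) (ht : 0 ≤ t) : 0 ≤ cellW t cCell := by
  rw [cellW_cCell]
  have h1 : 0 ≤ (11 + t) ^ 2 - 9 := by nlinarith
  exact mul_nonneg (mul_nonneg h1 (sq_nonneg _)) (sq_nonneg _)

/-- the two-cell toy design `{n ↦ 286} →^q {c ↦ 286}` (`A = ∅`): rank `0`, the block `{c}` is tight with feeder `{n} ≠ {c}`. -/
def toy : BoxMonad := ⟨∅, {nCell}, {cCell}, fun _ => 0, fun _ => 286, fun _ => 286⟩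

theorem toy_rank : toy.rank = 0 := by decide

/-- the single-block instance of (B3.2⁺) fails at EVERY level `t ≥ 0` (`h¹(𝓔(t) ⊗ α) ≥ 286·(w_t(c) − w_t(n)) > 0`). -/
theorem toy_closure_fails (t : ℤ) (ht : 0 ≤ t) : ¬ ClosureIneq MCell.le toy t := by
  intro h
  have hU := h {nCell} (by decide)
  have hc : belowC MCell.le toy {nCell} = {cCell} := by decide
  have ha : belowA MCell.le toy {nCell} = ∅ := by decide
  rw [hc, ha] at hU
  simp [wOf, toy] at hU
  have := w_gap_pos t ht
  linarith

/-- `{c}` is a BAD tight block for the relation of record: tight (`286 = 286`), feeders `{n} ≠ {c}`. [`decide`] -/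
theorem toy_badTight : BadTightC MCell.le toy {cCell} := by
  refine ⟨by decide, by decide, ?_, ?_⟩
  · unfold TightC; decide
  · unfold IdBlockC; decide

/-- its `c₁`-defect on factor `1` is `286·((13,0,−1) − (12,0,−2)) = (286, 0, 286) ≠ 0` (the face `b3cohom.py` prints). -/
theorem toy_deltaC : deltaC MCell.le toy {cCell} 1 = (286, 0, 286) := by decide

/-- so the toy violates the Krull–Schmidt law AND g0's `c₁`-face … -/
theorem toy_not_ks : ¬ KSTightC MCell.le toy ∧ ¬ NoBadTightC MCell.le toy := by
  refine ⟨fun h => ?_, fun h => ?_⟩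
  · exact toy_badTight.2.2.2 (h {cCell} (by decide) (by decide) toy_badTight.2.2.1)
  · have := h {cCell} (by decide) (by decide) toy_badTight.2.2.1 1
    rw [toy_deltaC] at this
    exact absurd this (by decide)

/-- … and, by §6, so does every positive multiple of it under every labelling (the lift corollary, instantiated). -/
theorem toy_lift_dead {L' : MCell → MCell → Prop} [DecidableRel L'] (hL' : ∀ x y, L' x y → MCell.le x y) {k : ℤ}
    (hk : 0 < k) : ¬ (HallQ L' (toy.smul k) ∧ KSTightC L' (toy.smul k)) :=
  lift_inherits_badTightC hL' (fun n hn => by simp [toy] at hn ⊢) hk toy_badTight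

/-- … and the closure violation too is inherited by every positive multiple under every labelling. -/
theorem toy_lift_closure_fails {L' : MCell → MCell → Prop} [DecidableRel L'] (hL' : ∀ x y, L' x y → MCell.le x y)
    (t : ℤ) (ht : 0 ≤ t) {k : ℤ} (hk : 0 < k) : ¬ ClosureIneq L' (toy.smul k) t :=
  lift_inherits_closure_violation hL'
    (fun c hc => by
      simp only [toy, Finset.mem_singleton] at hc ⊢
      subst hc
      exact mul_nonneg (by norm_num) (cellW_cCell_nonneg t ht))
    (fun a ha => by simp [toy] at ha) hk (toy_closure_fails t ht)

/-- the maximal tight `C`-block of the toy is `{cCell}` — the one identity test of §6c fails there (cf. `toy_badTight`). -/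
theorem toy_tightUnionC : tightUnionC MCell.le toy = {cCell} :=
  Finset.Subset.antisymm (tightUnionC_subset MCell.le toy) (subset_tightUnionC toy_badTight.1 toy_badTight.2.2.1)

end Summit.HodgeConjecture.HodgeConjecture.Cruxes.BlochSeedDiscOne.B3MonadCohomology
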